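import Mathlib.Analysis.Calculus.LineDeriv.IntegrationByParts
import Mathlib.Analysis.Calculus.ContDiff.Operations
import Mathlib.Analysis.Calculus.Deriv.Inv
import Mathlib.Analysis.SpecialFunctions.ExpDeriv
import Mathlib.MeasureTheory.Function.LocallyIntegrable
import HarnessLib

/-!
# Non-stationary phase in one direction: one integration by parts against `e^{iλψ}`

(topic `Literature/Analysis/Asymptotics`; namespace `Literature.Analysis.Asymptotics`; proved, no
named fact)

On a finite-dimensional real vector space `V` with a Haar measure `μ`, for a real phase `ψ`, a
complex amplitude `b` of class `C¹` with compact support and a direction `v ∈ V` along which the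
phase is non-stationary on the support of the amplitude (`∂_v ψ ≠ 0` on `tsupport b`), one
integration by parts along `v` gives

  `∫ e^{iλψ} b dμ = (i/λ) ∫ e^{iλψ} ∂_v (b / ∂_v ψ) dμ`        (`λ ≠ 0`),

hence `|∫ e^{iλψ} b dμ| ≤ |λ|⁻¹ ∫ |∂_v (b / ∂_v ψ)| dμ ≤ |λ|⁻¹ (c₀⁻¹ ∫ |∂_v b| + c₀⁻² ∫ |b| |∂_v ∂_v ψ|)`
when `|∂_v ψ| ≥ c₀ > 0` on `tsupport b`. This is the first-order (gradient) non-stationary phase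
estimate — as opposed to the second-derivative van der Corput bounds of
`Literature/Analysis/Fourier/VanDerCorput.lean`, `OscillatoryIntegralDecay.lean` on `ℝ` — in the
directional form in which it is used leafwise for the energy of *real-valued* Gaussian beams
`Re(a e^{iλφ})` (Sbierski, Anal. PDE 8 (2015), §4, third remark after the theorem: the cross terms
`Re(e^{2iλφ} Q)` of the energy density oscillate with the phase `2 Re φ`, whose leafwise gradient
`2 (γ̇♭)_{Σ_τ} ≠ 0` near the geodesic, and are of lower order after one integration by parts; the
amplitude there is `e^{-2λ Im φ} Q`, and the bounds below are applied for each `λ` with the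
`λ`-dependent amplitude, the Gaussian damping lemma paying `λ^{1/2}` for `∂_v e^{-2λ Im φ}`).

* `hasFDerivAt_cexp_phase`, `fderiv_cexp_phase_apply` — `∂_v e^{iλψ} = iλ (∂_v ψ) e^{iλψ}`
  (`|e^{iλψ}| = 1` is the tree's `SelbergDecay.norm_cexp_I_mul_real`, inlined where used);
* `integral_cexp_phase_mul_fderiv` — `∫ e^{iλψ} ∂_v g = −∫ e^{iλψ} (iλ ∂_v ψ) g` for `g ∈ C¹_c`,
  `ψ ∈ C¹` (Mathlib's integration by parts for line derivatives,
  `integral_mul_fderiv_eq_neg_fderiv_mul_of_integrable`);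
* `contDiff_div_phase`, `hasCompactSupport_div_phase` — `b / ∂_v ψ ∈ C¹_c` when `ψ ∈ C²`,
  `b ∈ C¹_c` and `∂_v ψ ≠ 0` on `tsupport b`;
* `integral_cexp_phase_mul_eq` — **the identity** `∫ e^{iλψ} b = (i/λ) ∫ e^{iλψ} ∂_v (b / ∂_v ψ)`;
* `norm_integral_cexp_phase_mul_le` — `|∫ e^{iλψ} b| ≤ |λ|⁻¹ ∫ |∂_v (b / ∂_v ψ)|`;
* `norm_fderiv_div_phase_le`, `norm_integral_cexp_phase_mul_le_of_le` — the expanded bound with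
  `|∂_v ψ| ≥ c₀` on `tsupport b`:
  `|∫ e^{iλψ} b| ≤ |λ|⁻¹ (c₀⁻¹ ∫ |∂_v b| + c₀⁻² ∫ |b| |∂_v∂_v ψ|)`.

## References

* J. Sbierski, *Characterisation of the energy of Gaussian beams on Lorentzian manifolds: with
  applications to black hole spacetimes*, Anal. PDE 8 (2015) 1379–1420, §4, third remark after
  the theorem (real-valued beams) (key `Sbierski2015`).
* L. Hörmander, *The analysis of linear partial differential operators I*, Grundlehren 256, Springer 1983,
  Thm. 7.7.1 (non-stationary phase by integration by parts) (key `HormanderALPDO1`).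
-/

noncomputable section

open MeasureTheory Set Filter
open scoped Topology ContDiff

namespace Literature.Analysis.Asymptotics

variable {V : Type*} [NormedAddCommGroup V] [NormedSpace ℝ V]

/-! ### The oscillatory factor `e^{iλψ}` -/

/-- `∂ e^{iλψ} = e^{iλψ} · iλ ∂ψ` at a point of differentiability of the phase. [folklore] -/
theorem hasFDerivAt_cexp_phase {ψ : V → ℝ} {y : V} (hψ : DifferentiableAt ℝ ψ y) (lam : ℝ) :
    HasFDerivAt (fun z ↦ Complex.exp (Complex.I * lam * ψ z))
      (Complex.exp (Complex.I * lam * ψ y) •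
        ((Complex.I * lam) • Complex.ofRealCLM.comp (fderiv ℝ ψ y))) y := by
  have h1 : HasFDerivAt (fun z ↦ (ψ z : ℂ)) (Complex.ofRealCLM.comp (fderiv ℝ ψ y)) y :=
    Complex.ofRealCLM.hasFDerivAt.comp y hψ.hasFDerivAt
  exact (h1.const_mul (Complex.I * lam)).cexp

/-- `∂_v e^{iλψ} = e^{iλψ} (iλ ∂_v ψ)` in a direction `v`. [folklore] -/
theorem fderiv_cexp_phase_apply {ψ : V → ℝ} {y : V} (hψ : DifferentiableAt ℝ ψ y) (lam : ℝ)
    (v : V) :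
    fderiv ℝ (fun z ↦ Complex.exp (Complex.I * lam * ψ z)) y v =
      Complex.exp (Complex.I * lam * ψ y) * (Complex.I * lam * (fderiv ℝ ψ y v : ℂ)) := by
  rw [(hasFDerivAt_cexp_phase hψ lam).fderiv]
  simp only [FunLike.coe_smul, Pi.smul_apply, ContinuousLinearMap.coe_comp,
    Function.comp_apply, Complex.ofRealCLM_apply, smul_eq_mul]

/-! ### The amplitude divided by the directional derivative of the phase -/

/-- `b / ∂_v ψ` as a real scalar multiple: `b(z) / ∂_vψ(z) = (∂_vψ(z))⁻¹ • b(z)`. [folklore] -/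
theorem div_phase_eq_smul (ψ : V → ℝ) (b : V → ℂ) (v : V) :
    (fun z ↦ b z / (fderiv ℝ ψ z v : ℂ)) = fun z ↦ (fderiv ℝ ψ z v)⁻¹ • b z := by
  funext z
  rw [Complex.real_smul, Complex.ofReal_inv, div_eq_inv_mul]

/-- **`b / ∂_v ψ` is `C¹`** when `ψ ∈ C²`, `b ∈ C¹` and `∂_v ψ ≠ 0` on `tsupport b` (off the
support the quotient vanishes identically near every point). [folklore] -/
theorem contDiff_div_phase {ψ : V → ℝ} {b : V → ℂ} (hψ : ContDiff ℝ 2 ψ) (hb : ContDiff ℝ 1 b)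
    {v : V} (hv : ∀ y ∈ tsupport b, fderiv ℝ ψ y v ≠ 0) :
    ContDiff ℝ 1 fun z ↦ b z / (fderiv ℝ ψ z v : ℂ) := by
  rw [div_phase_eq_smul]
  have hq : ContDiff ℝ 1 fun z ↦ fderiv ℝ ψ z v :=
    (hψ.fderiv_right (m := 1) le_rfl).clm_apply contDiff_const
  rw [contDiff_iff_contDiffAt]
  intro y
  by_cases hy : y ∈ tsupport b
  · exact ((hq.contDiffAt.inv (hv y hy)).smul hb.contDiffAt)
  · -- `b = 0` near `y`
    have hb0 : b =ᶠ[𝓝 y] 0 := notMem_tsupport_iff_eventuallyEq.mp hy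
    have h0 : (fun z ↦ (fderiv ℝ ψ z v)⁻¹ • b z) =ᶠ[𝓝 y] fun _ ↦ (0 : ℂ) := by
      filter_upwards [hb0] with z hz
      simp [hz]
    exact (contDiffAt_const (c := (0 : ℂ))).congr_of_eventuallyEq h0

/-- `b / ∂_v ψ` has compact support (contained in that of `b`). [folklore] -/
theorem hasCompactSupport_div_phase (ψ : V → ℝ) {b : V → ℂ} (hbs : HasCompactSupport b) (v : V) :
    HasCompactSupport fun z ↦ b z / (fderiv ℝ ψ z v : ℂ) :=
  hbs.mono' fun z hz ↦ by
    rw [Function.mem_support] at hz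
    exact subset_tsupport _ (Function.mem_support.2 fun hb0 ↦ hz (by rw [hb0, zero_div]))

/-- **The derivative of `b / ∂_v ψ` along `v`** at a point where `∂_v ψ ≠ 0`:
`∂_v (b / ∂_vψ) = (∂_vψ)⁻¹ ∂_v b − (∂_v∂_vψ / (∂_vψ)²) b`. [folklore] -/
theorem fderiv_div_phase_apply {ψ : V → ℝ} {b : V → ℂ} (hψ : ContDiff ℝ 2 ψ) (hb : ContDiff ℝ 1 b)
    (v : V) {y : V} (hy : fderiv ℝ ψ y v ≠ 0) :
    fderiv ℝ (fun z ↦ b z / (fderiv ℝ ψ z v : ℂ)) y v =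
      (fderiv ℝ ψ y v)⁻¹ • fderiv ℝ b y v +
        (-(fderiv ℝ (fun z ↦ fderiv ℝ ψ z v) y v / (fderiv ℝ ψ y v) ^ 2)) • b y := by
  rw [div_phase_eq_smul]
  have hq : ContDiff ℝ 1 fun z ↦ fderiv ℝ ψ z v :=
    (hψ.fderiv_right (m := 1) le_rfl).clm_apply contDiff_const
  have hqd : HasFDerivAt (fun z ↦ fderiv ℝ ψ z v) (fderiv ℝ (fun z ↦ fderiv ℝ ψ z v) y) y :=
    ((hq.differentiable one_ne_zero) y).hasFDerivAt
  have hbd : HasFDerivAt b (fderiv ℝ b y) y := ((hb.differentiable one_ne_zero) y).hasFDerivAt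
  have h1 : HasFDerivAt (fun z ↦ (fderiv ℝ ψ z v)⁻¹)
      ((ContinuousLinearMap.toSpanSingleton ℝ (-((fderiv ℝ ψ y v) ^ 2)⁻¹)).comp
        (fderiv ℝ (fun z ↦ fderiv ℝ ψ z v) y)) y :=
    (hasFDerivAt_inv hy).comp y hqd
  have h2 : HasFDerivAt (fun z ↦ (fderiv ℝ ψ z v)⁻¹ • b z)
      ((fderiv ℝ ψ y v)⁻¹ • fderiv ℝ b y +
        ((ContinuousLinearMap.toSpanSingleton ℝ (-((fderiv ℝ ψ y v) ^ 2)⁻¹)).comp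
          (fderiv ℝ (fun z ↦ fderiv ℝ ψ z v) y)).smulRight (b y)) y :=
    h1.smul hbd
  rw [h2.fderiv]
  simp only [FunLike.coe_add, Pi.add_apply, FunLike.coe_smul, Pi.smul_apply,
    ContinuousLinearMap.smulRight_apply, ContinuousLinearMap.coe_comp, Function.comp_apply,
    ContinuousLinearMap.toSpanSingleton_apply, smul_eq_mul]
  congr 1
  rw [div_eq_mul_inv, neg_mul_eq_mul_neg]

/-- **Pointwise bound for `∂_v (b / ∂_v ψ)`**: if `|∂_v ψ(y)| ≥ c₀ > 0` then
`|∂_v (b/∂_vψ)(y)| ≤ c₀⁻¹ |∂_v b(y)| + c₀⁻² |∂_v∂_vψ(y)| |b(y)|`. [folklore] -/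
theorem norm_fderiv_div_phase_le {ψ : V → ℝ} {b : V → ℂ} (hψ : ContDiff ℝ 2 ψ) (hb : ContDiff ℝ 1 b)
    (v : V) {y : V} {c₀ : ℝ} (hc₀ : 0 < c₀) (hy : c₀ ≤ |fderiv ℝ ψ y v|) :
    ‖fderiv ℝ (fun z ↦ b z / (fderiv ℝ ψ z v : ℂ)) y v‖ ≤
      c₀⁻¹ * ‖fderiv ℝ b y v‖ + c₀⁻¹ ^ 2 * (|fderiv ℝ (fun z ↦ fderiv ℝ ψ z v) y v| * ‖b y‖) := by
  have hq0 : fderiv ℝ ψ y v ≠ 0 := fun h ↦ by rw [h, abs_zero] at hy; exact absurd hy (not_le.2 hc₀)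
  have hinv : |fderiv ℝ ψ y v|⁻¹ ≤ c₀⁻¹ := (inv_le_inv₀ (hc₀.trans_le hy) hc₀).2 hy
  have hinv2 : (|fderiv ℝ ψ y v| ^ 2)⁻¹ ≤ c₀⁻¹ ^ 2 := by
    rw [← inv_pow]
    exact pow_le_pow_left₀ (by positivity) hinv 2
  rw [fderiv_div_phase_apply hψ hb v hq0]
  refine (norm_add_le _ _).trans (add_le_add ?_ ?_)
  · rw [norm_smul, Real.norm_eq_abs, abs_inv]
    exact mul_le_mul_of_nonneg_right hinv (norm_nonneg _)
  · rw [norm_smul, Real.norm_eq_abs, abs_neg, abs_div, abs_pow, div_eq_mul_inv]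
    calc |fderiv ℝ (fun z ↦ fderiv ℝ ψ z v) y v| * (|fderiv ℝ ψ y v| ^ 2)⁻¹ * ‖b y‖
        ≤ |fderiv ℝ (fun z ↦ fderiv ℝ ψ z v) y v| * c₀⁻¹ ^ 2 * ‖b y‖ := by
          gcongr
      _ = c₀⁻¹ ^ 2 * (|fderiv ℝ (fun z ↦ fderiv ℝ ψ z v) y v| * ‖b y‖) := by ring

variable [FiniteDimensional ℝ V] [MeasurableSpace V] [BorelSpace V] {μ : Measure V}
  [μ.IsAddHaarMeasure]

/-! ### One integration by parts -/

/-- **Integration by parts against the oscillatory factor**: for `ψ ∈ C¹`, `g ∈ C¹` with compact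
support and any direction `v`, `∫ e^{iλψ} ∂_v g dμ = −∫ e^{iλψ} (iλ ∂_v ψ) g dμ` (no boundary terms;
Mathlib's integration by parts for line derivatives, all three products being continuous with
compact support). [cite: HormanderALPDO1, Thm. 7.7.1 (proof)] -/
theorem integral_cexp_phase_mul_fderiv {ψ : V → ℝ} {g : V → ℂ} (hψ : ContDiff ℝ 1 ψ)
    (hg : ContDiff ℝ 1 g) (hgs : HasCompactSupport g) (lam : ℝ) (v : V) :
    ∫ y, Complex.exp (Complex.I * lam * ψ y) * fderiv ℝ g y v ∂μ =
      -∫ y, Complex.exp (Complex.I * lam * ψ y) *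
        ((Complex.I * lam * (fderiv ℝ ψ y v : ℂ)) * g y) ∂μ := by
  have hψd : Differentiable ℝ ψ := hψ.differentiable one_ne_zero
  have hψc : Continuous ψ := hψ.continuous
  have hgd : Differentiable ℝ g := hg.differentiable one_ne_zero
  have hec : Continuous fun z ↦ Complex.exp (Complex.I * lam * ψ z) := by fun_prop
  -- the derivative of the oscillatory factor
  have hf' : ∀ y, fderiv ℝ (fun z ↦ Complex.exp (Complex.I * lam * ψ z)) y v =
      Complex.exp (Complex.I * lam * ψ y) * (Complex.I * lam * (fderiv ℝ ψ y v : ℂ)) :=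
    fun y ↦ fderiv_cexp_phase_apply (hψd y) lam v
  have hψ'c : Continuous fun y ↦ fderiv ℝ ψ y v :=
    (hψ.continuous_fderiv one_ne_zero).clm_apply continuous_const
  have hg'c : Continuous fun y ↦ fderiv ℝ g y v :=
    (hg.continuous_fderiv one_ne_zero).clm_apply continuous_const
  -- integrability of the three products
  have h1 : Integrable (fun y ↦ fderiv ℝ (fun z ↦ Complex.exp (Complex.I * lam * ψ z)) y v * g y)
      μ := by
    simp only [hf']
    refine Continuous.integrable_of_hasCompactSupport (by fun_prop) ?_
    exact hgs.mul_left
  have h2 : Integrable (fun y ↦ Complex.exp (Complex.I * lam * ψ y) * fderiv ℝ g y v) μ :=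
    Continuous.integrable_of_hasCompactSupport (hec.mul hg'c) (hgs.fderiv_apply ℝ v).mul_left
  have h3 : Integrable (fun y ↦ Complex.exp (Complex.I * lam * ψ y) * g y) μ :=
    Continuous.integrable_of_hasCompactSupport (hec.mul hg.continuous) hgs.mul_left
  rw [integral_mul_fderiv_eq_neg_fderiv_mul_of_integrable h1 h2 h3
    (fun y _ ↦ (hasFDerivAt_cexp_phase (hψd y) lam).differentiableAt) (fun y _ ↦ hgd y)]
  simp only [hf']
  congr 1
  refine integral_congr_ae (Eventually.of_forall fun y ↦ ?_)
  simp only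
  ring

/-! ### The identity and the bounds -/

/-- **Non-stationary phase in one direction (identity).** For `ψ ∈ C²`, `b ∈ C¹` with compact
support, a direction `v` with `∂_v ψ ≠ 0` on `tsupport b`, and `λ ≠ 0`:
`∫ e^{iλψ} b dμ = (i/λ) ∫ e^{iλψ} ∂_v (b / ∂_vψ) dμ`. Proof: integrate by parts with
`g = b/(iλ ∂_vψ) ∈ C¹_c`, using `∂_v e^{iλψ} = iλ ∂_vψ e^{iλψ}`.
[cite: HormanderALPDO1, Thm. 7.7.1 (proof, one step)] -/
theorem integral_cexp_phase_mul_eq {ψ : V → ℝ} {b : V → ℂ} (hψ : ContDiff ℝ 2 ψ)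
    (hb : ContDiff ℝ 1 b) (hbs : HasCompactSupport b) {v : V}
    (hv : ∀ y ∈ tsupport b, fderiv ℝ ψ y v ≠ 0) {lam : ℝ} (hlam : lam ≠ 0) :
    ∫ y, Complex.exp (Complex.I * lam * ψ y) * b y ∂μ =
      (Complex.I / lam) * ∫ y, Complex.exp (Complex.I * lam * ψ y) *
        fderiv ℝ (fun z ↦ b z / (fderiv ℝ ψ z v : ℂ)) y v ∂μ := by
  set h : V → ℂ := fun z ↦ b z / (fderiv ℝ ψ z v : ℂ) with hh
  have hhC : ContDiff ℝ 1 h := contDiff_div_phase hψ hb hv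
  have hhs : HasCompactSupport h := hasCompactSupport_div_phase ψ hbs v
  have hκ : (Complex.I * lam : ℂ) ≠ 0 := mul_ne_zero Complex.I_ne_zero (by exact_mod_cast hlam)
  -- integrate by parts with `g = (iλ)⁻¹ h`
  set g : V → ℂ := fun z ↦ (Complex.I * lam)⁻¹ * h z with hg
  have hgC : ContDiff ℝ 1 g := contDiff_const.mul hhC
  have hgs : HasCompactSupport g := hhs.mul_left
  have hibp := integral_cexp_phase_mul_fderiv (μ := μ) (hψ.of_le (by norm_num)) hgC hgs lam v
  -- `∂_v g = (iλ)⁻¹ ∂_v h`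
  have hg' : ∀ y, fderiv ℝ g y v = (Complex.I * lam)⁻¹ * fderiv ℝ h y v := by
    intro y
    rw [hg, fderiv_const_mul ((hhC.differentiable one_ne_zero) y)]
    rfl
  -- `(iλ ∂_vψ) g = b` pointwise
  have hprod : ∀ y, (Complex.I * lam * (fderiv ℝ ψ y v : ℂ)) * g y = b y := by
    intro y
    by_cases hy : y ∈ tsupport b
    · have hq : (fderiv ℝ ψ y v : ℂ) ≠ 0 := by exact_mod_cast hv y hy
      have hl : (lam : ℂ) ≠ 0 := by exact_mod_cast hlam
      rw [hg, hh]
      field_simp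
    · rw [image_eq_zero_of_notMem_tsupport hy, hg, hh]
      simp [image_eq_zero_of_notMem_tsupport hy]
  simp only [hg', hprod] at hibp
  -- `hibp : ∫ e · ((iλ)⁻¹ ∂_v h) = −∫ e · b`
  have hlin : ∫ y, Complex.exp (Complex.I * lam * ψ y) * ((Complex.I * lam)⁻¹ * fderiv ℝ h y v) ∂μ =
      (Complex.I * lam)⁻¹ * ∫ y, Complex.exp (Complex.I * lam * ψ y) * fderiv ℝ h y v ∂μ := by
    rw [← integral_const_mul]
    refine integral_congr_ae (Eventually.of_forall fun y ↦ ?_)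
    simp only
    ring
  rw [hlin] at hibp
  have hI : (Complex.I / lam : ℂ) = -(Complex.I * lam)⁻¹ := by
    field_simp
    rw [Complex.I_sq]
    ring
  rw [hI, neg_mul, hibp, neg_neg]

/-- **Non-stationary phase in one direction (bound).** Under the hypotheses of
`integral_cexp_phase_mul_eq`, `|∫ e^{iλψ} b dμ| ≤ |λ|⁻¹ ∫ |∂_v (b / ∂_vψ)| dμ`.
[cite: HormanderALPDO1, Thm. 7.7.1] -/
theorem norm_integral_cexp_phase_mul_le {ψ : V → ℝ} {b : V → ℂ} (hψ : ContDiff ℝ 2 ψ)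
    (hb : ContDiff ℝ 1 b) (hbs : HasCompactSupport b) {v : V}
    (hv : ∀ y ∈ tsupport b, fderiv ℝ ψ y v ≠ 0) {lam : ℝ} (hlam : lam ≠ 0) :
    ‖∫ y, Complex.exp (Complex.I * lam * ψ y) * b y ∂μ‖ ≤
      |lam|⁻¹ * ∫ y, ‖fderiv ℝ (fun z ↦ b z / (fderiv ℝ ψ z v : ℂ)) y v‖ ∂μ := by
  rw [integral_cexp_phase_mul_eq hψ hb hbs hv hlam, norm_mul, norm_div, Complex.norm_I,
    Complex.norm_real, Real.norm_eq_abs, one_div]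
  refine mul_le_mul_of_nonneg_left ?_ (inv_nonneg.2 (abs_nonneg _))
  -- `|e^{iλψ}| = 1` (as in `SelbergTransformDecayProofs.norm_cexp_I_mul_real`)
  have hn : ∀ y, ‖Complex.exp (Complex.I * lam * ψ y)‖ = 1 := fun y ↦ by
    rw [show Complex.I * lam * ψ y = ((lam * ψ y : ℝ) : ℂ) * Complex.I by push_cast; ring,
      Complex.norm_exp_ofReal_mul_I]
  refine (norm_integral_le_integral_norm _).trans (le_of_eq ?_)
  refine integral_congr_ae (Eventually.of_forall fun y ↦ ?_)
  simp only [norm_mul, hn, one_mul]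

/-- **Non-stationary phase in one direction (expanded bound).** For `ψ ∈ C²`, `b ∈ C¹` with
compact support, a direction `v` with `|∂_v ψ| ≥ c₀ > 0` on `tsupport b`, and `λ ≠ 0`:
`|∫ e^{iλψ} b dμ| ≤ |λ|⁻¹ (c₀⁻¹ ∫ |∂_v b| dμ + c₀⁻² ∫ |∂_v∂_vψ| |b| dμ)`.
[cite: HormanderALPDO1, Thm. 7.7.1; Sbierski2015, §4 (third remark)] -/
theorem norm_integral_cexp_phase_mul_le_of_le {ψ : V → ℝ} {b : V → ℂ} (hψ : ContDiff ℝ 2 ψ)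
    (hb : ContDiff ℝ 1 b) (hbs : HasCompactSupport b) {v : V} {c₀ : ℝ} (hc₀ : 0 < c₀)
    (hv : ∀ y ∈ tsupport b, c₀ ≤ |fderiv ℝ ψ y v|) {lam : ℝ} (hlam : lam ≠ 0) :
    ‖∫ y, Complex.exp (Complex.I * lam * ψ y) * b y ∂μ‖ ≤
      |lam|⁻¹ * (c₀⁻¹ * ∫ y, ‖fderiv ℝ b y v‖ ∂μ +
        c₀⁻¹ ^ 2 * ∫ y, |fderiv ℝ (fun z ↦ fderiv ℝ ψ z v) y v| * ‖b y‖ ∂μ) := by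
  have hv0 : ∀ y ∈ tsupport b, fderiv ℝ ψ y v ≠ 0 := fun y hy h ↦ by
    have := hv y hy; rw [h, abs_zero] at this; exact absurd this (not_le.2 hc₀)
  refine (norm_integral_cexp_phase_mul_le hψ hb hbs hv0 hlam).trans ?_
  refine mul_le_mul_of_nonneg_left ?_ (inv_nonneg.2 (abs_nonneg _))
  -- integrability of the two dominating terms
  have hb'c : Continuous fun y ↦ fderiv ℝ b y v :=
    (hb.continuous_fderiv one_ne_zero).clm_apply continuous_const
  have hq : ContDiff ℝ 1 fun z ↦ fderiv ℝ ψ z v :=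
    (hψ.fderiv_right (m := 1) le_rfl).clm_apply contDiff_const
  have hq'c : Continuous fun y ↦ fderiv ℝ (fun z ↦ fderiv ℝ ψ z v) y v :=
    (hq.continuous_fderiv one_ne_zero).clm_apply continuous_const
  have hi1 : Integrable (fun y ↦ ‖fderiv ℝ b y v‖) μ :=
    (Continuous.integrable_of_hasCompactSupport hb'c (hbs.fderiv_apply ℝ v)).norm
  have hi2 : Integrable (fun y ↦ |fderiv ℝ (fun z ↦ fderiv ℝ ψ z v) y v| * ‖b y‖) μ := by
    refine Continuous.integrable_of_hasCompactSupport (hq'c.abs.mul hb.continuous.norm) ?_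
    exact hbs.norm.mul_left
  rw [← integral_const_mul, ← integral_const_mul, ← integral_add (hi1.const_mul _)
    (hi2.const_mul _)]
  -- pointwise comparison (off `tsupport b` the quotient vanishes near the point)
  refine integral_mono_of_nonneg (Eventually.of_forall fun y ↦ norm_nonneg _)
    ((hi1.const_mul _).add (hi2.const_mul _)) (Eventually.of_forall fun y ↦ ?_)
  by_cases hy : y ∈ tsupport b
  · exact norm_fderiv_div_phase_le hψ hb v hc₀ (hv y hy)
  · have hb0 : b =ᶠ[𝓝 y] 0 := notMem_tsupport_iff_eventuallyEq.mp hy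
    have h0 : (fun z ↦ b z / (fderiv ℝ ψ z v : ℂ)) =ᶠ[𝓝 y] fun _ ↦ (0 : ℂ) := by
      filter_upwards [hb0] with z hz
      simp [hz]
    simp only [h0.fderiv_eq, fderiv_const_apply, zero_apply, norm_zero]
    positivity

end Literature.Analysis.Asymptotics
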